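import Mathlib
import HarnessLib

/-!
# Calculus stub `hasDerivAt_weightedAverage` of crux `CriticalCurveContinuity`

This file proves the calculus stub `hasDerivAt_weightedAverage` of line `registered` of the crux
`CriticalCurveContinuity` (stmt-CriticalPhenomena-7686), route `SAWMassiveIsingTilt` of
`CriticalPhenomena/SAWScalingLimit`.

The statement is pure one-variable calculus over a finite nonempty index type: for positive
weights `wᵢ` differentiable at `t` and constants `gᵢ`, the weighted average
`E(u) = (Σᵢ wᵢ(u) gᵢ) / (Σᵢ wᵢ(u))` has derivative at `t` equal to the covariance of `g` with the
logarithmic derivative `wᵢ' / wᵢ(t)` under the weights `wᵢ(t)`: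
`E'(t) = (Σ w·(g·(w'/w)))/(Σ w) − ((Σ w g)/(Σ w))·((Σ w·(w'/w))/(Σ w))`.
At finite mesh the expectation of an observable under the tilted law is such a weighted average,
and the skeleton's glue `hasDerivAt_tiltExpectation` consumes exactly this fact.
-/

namespace Summit.CriticalPhenomena.SAWScalingLimit.Theorems.SAWMassiveIsingTilt

/-- The derivative of a finite weighted average `(Σᵢ wᵢ(u) gᵢ)/(Σᵢ wᵢ(u))` with positive weights
differentiable at `t` is the covariance of `g` with the logarithmic derivative `wᵢ'/wᵢ(t)` under
the weights `wᵢ(t)`. -/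
theorem hasDerivAt_weightedAverage :
    ∀ {ι : Type} [Fintype ι] [Nonempty ι] (w : ι → ℝ → ℝ) (w' : ι → ℝ) (g : ι → ℝ) (t : ℝ),
      (∀ i, HasDerivAt (w i) (w' i) t) → (∀ i, 0 < w i t) →
        HasDerivAt (fun u => (∑ i, w i u * g i) / ∑ i, w i u)
          ((∑ i, w i t * (g i * (w' i / w i t))) / (∑ i, w i t) -
            ((∑ i, w i t * g i) / ∑ i, w i t) * ((∑ i, w i t * (w' i / w i t)) / ∑ i, w i t)) t := by
  intro ι _ _ w w' g t hw hpos
  -- the numerator `N(u) = Σ wᵢ(u) gᵢ` and the denominator `D(u) = Σ wᵢ(u)`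
  have hN : HasDerivAt (fun u => ∑ i, w i u * g i) (∑ i, w' i * g i) t :=
    HasDerivAt.fun_sum fun i _ => (hw i).mul_const (g i)
  have hD : HasDerivAt (fun u => ∑ i, w i u) (∑ i, w' i) t :=
    HasDerivAt.fun_sum fun i _ => hw i
  have hDpos : 0 < ∑ i, w i t := Finset.sum_pos (fun i _ => hpos i) Finset.univ_nonempty
  have hDne : (∑ i, w i t) ≠ 0 := hDpos.ne'
  -- termwise: `wᵢ (gᵢ (wᵢ'/wᵢ)) = wᵢ' gᵢ` and `wᵢ (wᵢ'/wᵢ) = wᵢ'`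
  have h1 : ∑ i, w i t * (g i * (w' i / w i t)) = ∑ i, w' i * g i := by
    refine Finset.sum_congr rfl fun i _ => ?_
    have hi : w i t ≠ 0 := (hpos i).ne'
    field_simp
  have h2 : ∑ i, w i t * (w' i / w i t) = ∑ i, w' i := by
    refine Finset.sum_congr rfl fun i _ => ?_
    have hi : w i t ≠ 0 := (hpos i).ne'
    field_simp
  -- quotient rule, then the algebraic identity
  refine (hN.fun_div hD hDne).congr_deriv ?_
  rw [h1, h2]
  field_simp

end Summit.CriticalPhenomena.SAWScalingLimit.Theorems.SAWMassiveIsingTilt
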